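import Literature.Barriers.AtomisticToContinuum.OneDimensionalHardCoreRodsRotate
import Literature.Barriers.AtomisticToContinuum.OneDimensionalHardCoreRodsMajorant
import Mathlib.MeasureTheory.Group.Measure
import HarnessLib

/-!
# Hard rods: translation invariance of the one-body density matrix

`Literature/Barriers/AtomisticToContinuum/` (D-0021 barrier catalogue), sub-problem
`BoseEinsteinCondensation`; part of the typed proof of the rod barrier `OneDimensionalHardRods`
(`OneDimensionalHardCoreRods.lean`, eighth audit of `OneDimensionalHardCore`, 2026-08-16).

Faithfulness plumbing, step 2: the rod one-body density matrix is a function of the displacement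
on the ring, `ρ_N(x, y) = ρ_N(0, (y − x) mod L)` for `x, y ∈ [0, L)`
(`rodDensityMatrix_eq_shift`). Ingredients: the rotation `u ↦ (u + c) mod L` preserves Lebesgue
measure on the chart `[0, L)` (`map_ringRotate_volume`: it is a translation on `[0, L − c)` and on
`[L − c, L)`; `measure_preimage_add_right`), hence the coordinatewise rotation preserves the box
measure (`measurePreserving_pi`), the rod state is measurable (`measurable_rodState`) and rotation
invariant (`rodState_ringRotate` of `OneDimensionalHardCoreRodsRotate.lean`).

## References

* [MazzantiEtAl2008] F. Mazzanti et al., Phys. Rev. Lett. 100 (2008) 020401: p. 3 ("From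
  translational invariance arguments … `n₁(0) = n`").
-/

noncomputable section

open MeasureTheory Finset Filter Topology
open scoped BigOperators Real

namespace Literature.Barriers.AtomisticToContinuum.BoseGas

section Shift

variable {N n : ℕ} {L : ℝ}

/-! #### Measurability of the rod state -/

/-- The rank is a finite sum of indicators, hence measurable (as a real function). [folklore] -/
theorem measurable_rodRank (j : Fin N) : Measurable fun x : Fin N → ℝ => (rodRank x j : ℝ) := by
  have h : (fun x : Fin N → ℝ => (rodRank x j : ℝ)) =
      fun x => ∑ i : Fin N, if x i < x j then (1 : ℝ) else 0 := by
    funext x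
    unfold rodRank
    rw [Finset.card_filter]
    push_cast
    rfl
  rw [h]
  refine Finset.measurable_sum _ fun i _ => ?_
  exact Measurable.ite (measurableSet_lt (measurable_pi_apply i) (measurable_pi_apply j))
    measurable_const measurable_const

/-- The rod coordinates are measurable. [folklore] -/
theorem measurable_rodCompress (a : ℝ) : Measurable (rodCompress (N := N) a) := by
  refine measurable_pi_iff.mpr fun j => ?_
  unfold rodCompress
  exact (measurable_pi_apply j).sub (measurable_const.mul (measurable_rodRank j))

/-- The cyclic distance is continuous. [folklore] -/
theorem continuous_ringDist (L : ℝ) : Continuous fun p : ℝ × ℝ => ringDist L p.1 p.2 := by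
  unfold ringDist; fun_prop

/-- The admissible set is measurable. [folklore] -/
theorem measurableSet_rodAdmissible (L a : ℝ) :
    MeasurableSet {x : Fin N → ℝ | rodAdmissible L a x} := by
  have h : {x : Fin N → ℝ | rodAdmissible L a x} =
      ⋂ i : Fin N, ⋂ j : Fin N, {x | i ≠ j → a ≤ ringDist L (x i) (x j)} := by
    ext x
    simp only [Set.mem_setOf_eq, Set.mem_iInter, rodAdmissible]
  rw [h]
  refine MeasurableSet.iInter fun i => MeasurableSet.iInter fun j => ?_
  by_cases hij : i = j
  · have : {x : Fin N → ℝ | i ≠ j → a ≤ ringDist L (x i) (x j)} = Set.univ := by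
      ext x; simp [hij]
    rw [this]; exact MeasurableSet.univ
  · have : {x : Fin N → ℝ | i ≠ j → a ≤ ringDist L (x i) (x j)} =
        {x | a ≤ ringDist L (x i) (x j)} := by
      ext x; simp [hij]
    rw [this]
    have hm : Measurable ((fun p : ℝ × ℝ => ringDist L p.1 p.2) ∘ fun x : Fin N → ℝ => (x i, x j)) :=
      (continuous_ringDist L).measurable.comp ((measurable_pi_apply i).prodMk (measurable_pi_apply j))
    exact measurableSet_le measurable_const hm

/-- The rod state is measurable. [folklore] -/
theorem measurable_rodState (N : ℕ) (L a : ℝ) : Measurable (rodState N L a) := by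
  unfold rodState
  refine measurable_const.mul ?_
  exact ((continuous_girardeauState N (L - N * a)).measurable.comp
    (measurable_rodCompress a)).indicator (measurableSet_rodAdmissible L a)

/-! #### The rotation preserves Lebesgue measure on the chart -/

/-- The rotation is measurable (quotient map, `equivIco`, inclusion). [folklore] -/
theorem measurable_ringRotate (hL : 0 < L) (c : ℝ) : Measurable (ringRotate hL c) := by
  haveI : Fact (0 < L) := ⟨hL⟩
  have h : ringRotate hL c = fun u => ((AddCircle.equivIco L 0) ((u + c : ℝ) : AddCircle L) : ℝ) := by
    funext u
    unfold ringRotate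
    rw [AddCircle.equivIco, QuotientAddGroup.equivIcoMod_coe]
  rw [h]
  exact measurable_subtype_coe.comp ((AddCircle.measurableEquivIco L 0).measurable.comp
    (AddCircle.measurable_mk'.comp (measurable_id.add_const c)))

/-- **The rotation preserves Lebesgue measure on `[0, L)`** (for `c ∈ [0, L)`): on `[0, L − c)` it
is the translation by `c`, on `[L − c, L)` the translation by `c − L`. [folklore] -/
theorem map_ringRotate_volume (hL : 0 < L) {c : ℝ} (hc : c ∈ Set.Ico 0 L) :
    Measure.map (ringRotate hL c) (volume.restrict (Set.Ico 0 L)) = volume.restrict (Set.Ico 0 L) := by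
  refine Measure.ext fun S hS => ?_
  rw [Measure.map_apply (measurable_ringRotate hL c) hS, Measure.restrict_apply (hS.preimage
    (measurable_ringRotate hL c)), Measure.restrict_apply hS]
  -- split the chart into the unwrapped and the wrapped part
  set A : Set ℝ := Set.Ico 0 (L - c) with hA
  set B : Set ℝ := Set.Ico (L - c) L with hB
  have hsplit : ringRotate hL c ⁻¹' S ∩ Set.Ico 0 L =
      ((fun u => u + c) ⁻¹' (S ∩ Set.Ico c L)) ∪ ((fun u => u + (c - L)) ⁻¹' (S ∩ Set.Ico 0 c)) := by
    ext u
    simp only [Set.mem_inter_iff, Set.mem_preimage, Set.mem_union, Set.mem_Ico]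
    constructor
    · rintro ⟨hS', h0, h1⟩
      by_cases hw : u + c < L
      · left
        rw [ringRotate_of_lt hL h0 hc.1 hw] at hS'
        exact ⟨hS', by linarith [hc.1], hw⟩
      · right
        rw [ringRotate_of_ge hL h1 hc.2 (not_lt.mp hw)] at hS'
        refine ⟨by rwa [show u + (c - L) = u + c - L by ring], by linarith [not_lt.mp hw], ?_⟩
        linarith
    · rintro (⟨hS', h0, h1⟩ | ⟨hS', h0, h1⟩)
      · have hu0 : 0 ≤ u := by linarith [hc.2]
        refine ⟨?_, hu0, by linarith [hc.1]⟩
        rwa [ringRotate_of_lt hL hu0 hc.1 h1]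
      · have huL : u < L := by linarith [hc.1]
        have hge : L ≤ u + c := by linarith
        refine ⟨?_, by linarith [hc.2], huL⟩
        rw [ringRotate_of_ge hL huL hc.2 hge, show u + c - L = u + (c - L) by ring]
        exact hS'
  have hdisj : Disjoint ((fun u => u + c) ⁻¹' (S ∩ Set.Ico c L))
      ((fun u => u + (c - L)) ⁻¹' (S ∩ Set.Ico 0 c)) := by
    rw [Set.disjoint_left]
    intro u hu hu'
    simp only [Set.mem_preimage, Set.mem_inter_iff, Set.mem_Ico] at hu hu'
    linarith [hu.2.2, hu'.2.1]
  rw [hsplit, measure_union hdisj ((hS.inter measurableSet_Ico).preimage (measurable_id.add_const _)),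
    measure_preimage_add_right, measure_preimage_add_right, ← measure_union]
  · congr 1
    rw [← Set.inter_union_distrib_left, Set.union_comm, Set.Ico_union_Ico_eq_Ico hc.1 hc.2.le]
  · exact Set.disjoint_left.mpr fun u hu hu' => by
      simp only [Set.mem_inter_iff, Set.mem_Ico] at hu hu'; linarith [hu.2.1, hu'.2.2]
  · exact hS.inter measurableSet_Ico

/-- The rotation is measure preserving on the chart, every `c`. [folklore] -/
theorem measurePreserving_ringRotate (hL : 0 < L) (c : ℝ) :
    MeasurePreserving (ringRotate hL c) (volume.restrict (Set.Ico 0 L)) (volume.restrict (Set.Ico 0 L)) := by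
  have hc : toIcoMod hL 0 c ∈ Set.Ico 0 L := by
    have := toIcoMod_mem_Ico hL 0 c; rwa [zero_add] at this
  have hfun : ringRotate hL c = ringRotate hL (toIcoMod hL 0 c) := by
    funext u; exact ringRotate_eq_ringRotate_toIcoMod hL c u
  rw [hfun]
  exact ⟨measurable_ringRotate hL _, map_ringRotate_volume hL hc⟩

/-- The coordinatewise rotation preserves the box measure. [folklore] -/
theorem measurePreserving_pi_ringRotate (hL : 0 < L) (c : ℝ) :
    MeasurePreserving (fun d : Fin n → ℝ => fun i => ringRotate hL c (d i))
      (Measure.pi fun _ : Fin n => volume.restrict (Set.Ico 0 L))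
      (Measure.pi fun _ : Fin n => volume.restrict (Set.Ico 0 L)) :=
  measurePreserving_pi _ _ fun _ => measurePreserving_ringRotate hL c

/-! #### Translation invariance of the density matrix -/

/-- Rotating the inserted point: `snoc (R d) (R s) = R (snoc d s)`. [folklore] -/
theorem snoc_ringRotate (hL : 0 < L) (c : ℝ) (d : Fin n → ℝ) (s : ℝ) :
    (Fin.snoc (fun i => ringRotate hL c (d i)) (ringRotate hL c s) : Fin (n + 1) → ℝ) =
      fun j => ringRotate hL c ((Fin.snoc d s : Fin (n + 1) → ℝ) j) := by
  funext j
  refine Fin.lastCases ?_ (fun i => ?_) j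
  · simp [Fin.snoc_last]
  · simp [Fin.snoc_castSucc]

/-- **Translation invariance of the rod one-body density matrix**: for `x, y ∈ [0, L)`,
`ρ_N(x, y) = ρ_N(0, (y − x) mod L)`. [cite: MazzantiEtAl2008, p. 3] -/
theorem rodDensityMatrix_eq_shift (hL : 0 < L) (a : ℝ) {x y : ℝ} (hx : x ∈ Set.Ico 0 L)
    (hy : y ∈ Set.Ico 0 L) :
    rodDensityMatrix (n + 1) L a x y = rodDensityMatrix (n + 1) L a 0 (toIcoMod hL 0 (y - x)) := by
  set s : ℝ := toIcoMod hL 0 (y - x) with hs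
  have hs_mem : s ∈ Set.Ico 0 L := by
    have := toIcoMod_mem_Ico hL 0 (y - x); rwa [zero_add] at this
  -- the two box integrals
  set F : (Fin n → ℝ) → ℝ := fun X => rodState (n + 1) L a (Fin.snoc X x) * rodState (n + 1) L a (Fin.snoc X y)
    with hF
  set G : (Fin n → ℝ) → ℝ := fun X => rodState (n + 1) L a (Fin.snoc X 0) * rodState (n + 1) L a (Fin.snoc X s)
    with hG
  have hFdef : rodDensityMatrix (n + 1) L a x y = (n + 1 : ℝ) *
      ∫ X in Set.pi Set.univ (fun _ : Fin n => Set.Icc (0 : ℝ) L), F X := rfl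
  have hGdef : rodDensityMatrix (n + 1) L a 0 s = (n + 1 : ℝ) *
      ∫ X in Set.pi Set.univ (fun _ : Fin n => Set.Icc (0 : ℝ) L), G X := rfl
  rw [hFdef, hGdef]
  congr 1
  -- measurability
  have hmeasF : Measurable F :=
    ((measurable_rodState (n + 1) L a).comp (continuous_snoc_const x).measurable).mul
      ((measurable_rodState (n + 1) L a).comp (continuous_snoc_const y).measurable)
  have hmeasG : Measurable G :=
    ((measurable_rodState (n + 1) L a).comp (continuous_snoc_const 0).measurable).mul
      ((measurable_rodState (n + 1) L a).comp (continuous_snoc_const s).measurable)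
  -- pass to the half-open box
  have hae : (Set.pi Set.univ fun _ : Fin n => Set.Ico (0 : ℝ) L) =ᵐ[volume]
      (Set.pi Set.univ fun _ : Fin n => Set.Icc (0 : ℝ) L) := by
    rw [volume_pi]; exact Measure.pi_Ico_ae_eq_pi_Icc
  rw [← setIntegral_congr_set hae, ← setIntegral_congr_set hae]
  have hμ : (volume : Measure (Fin n → ℝ)).restrict (Set.pi Set.univ fun _ => Set.Ico (0 : ℝ) L) =
      Measure.pi fun _ : Fin n => (volume : Measure ℝ).restrict (Set.Ico 0 L) := by
    rw [volume_pi, Measure.restrict_pi_pi]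
  -- the rotation by `x`
  set R : (Fin n → ℝ) → (Fin n → ℝ) := fun d => fun i => ringRotate hL x (d i) with hR
  have hRmp := measurePreserving_pi_ringRotate (n := n) hL x
  -- `F ∘ R = G` on the half-open box
  have hx0 : ringRotate hL x 0 = x := by
    rw [ringRotate_of_lt hL le_rfl hx.1 (by rw [zero_add]; exact hx.2), zero_add]
  have hxs : ringRotate hL x s = y := by
    unfold ringRotate
    rw [hs, toIcoMod_eq_iff hL]
    refine ⟨by rw [zero_add]; exact hy, -toIcoDiv hL 0 (y - x), ?_⟩
    have h := toIcoMod_add_toIcoDiv_zsmul hL 0 (y - x)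
    rw [neg_zsmul]
    linarith [h, hs]
  have hFR : ∀ d ∈ Set.pi Set.univ (fun _ : Fin n => Set.Ico (0 : ℝ) L), F (R d) = G d := by
    intro d hd
    have hd' : ∀ i, d i ∈ Set.Ico (0 : ℝ) L := fun i => hd i (Set.mem_univ _)
    have h0 : ∀ i, (Fin.snoc d 0 : Fin (n + 1) → ℝ) i ∈ Set.Ico (0 : ℝ) L := by
      intro i; refine Fin.lastCases ?_ (fun j => ?_) i
      · simpa [Fin.snoc_last] using (⟨le_rfl, hL⟩ : (0 : ℝ) ∈ Set.Ico 0 L)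
      · simpa [Fin.snoc_castSucc] using hd' j
    have h1 : ∀ i, (Fin.snoc d s : Fin (n + 1) → ℝ) i ∈ Set.Ico (0 : ℝ) L := by
      intro i; refine Fin.lastCases ?_ (fun j => ?_) i
      · simpa [Fin.snoc_last] using hs_mem
      · simpa [Fin.snoc_castSucc] using hd' j
    have e0 := snoc_ringRotate hL x d 0
    rw [hx0] at e0
    have es := snoc_ringRotate hL x d s
    rw [hxs] at es
    simp only [hF, hG, hR]
    rw [e0, es, rodState_ringRotate hL a x h0, rodState_ringRotate hL a x h1]
  -- change of variables
  calc ∫ X in Set.pi Set.univ (fun _ : Fin n => Set.Ico (0 : ℝ) L), F X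
      = ∫ X, F X ∂(Measure.pi fun _ : Fin n => (volume : Measure ℝ).restrict (Set.Ico 0 L)) := by
        rw [hμ]
    _ = ∫ X, F X ∂(Measure.map R (Measure.pi fun _ : Fin n =>
          (volume : Measure ℝ).restrict (Set.Ico 0 L))) := by rw [hRmp.map_eq]
    _ = ∫ d, F (R d) ∂(Measure.pi fun _ : Fin n => (volume : Measure ℝ).restrict (Set.Ico 0 L)) :=
        integral_map hRmp.measurable.aemeasurable hmeasF.aestronglyMeasurable
    _ = ∫ d in Set.pi Set.univ (fun _ : Fin n => Set.Ico (0 : ℝ) L), F (R d) := by rw [hμ]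
    _ = ∫ d in Set.pi Set.univ (fun _ : Fin n => Set.Ico (0 : ℝ) L), G d :=
        setIntegral_congr_fun (MeasurableSet.univ_pi fun _ => measurableSet_Ico) hFR

/-! #### The zero-momentum occupation as a single integral over the displacement -/

/-- The density matrix `s ↦ ρ_N(0, s)` is measurable. [folklore] -/
theorem measurable_rodDensityMatrix_zero (n : ℕ) (L a : ℝ) :
    Measurable fun s : ℝ => rodDensityMatrix (n + 1) L a 0 s := by
  have hdef : (fun s : ℝ => rodDensityMatrix (n + 1) L a 0 s) = fun s => (n + 1 : ℝ) *
      ∫ X in Set.pi Set.univ (fun _ : Fin n => Set.Icc (0 : ℝ) L),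
        rodState (n + 1) L a (Fin.snoc X 0) * rodState (n + 1) L a (Fin.snoc X s) := rfl
  rw [hdef]
  refine measurable_const.mul ?_
  have hF : StronglyMeasurable (Function.uncurry fun (s : ℝ) (X : Fin n → ℝ) =>
      rodState (n + 1) L a (Fin.snoc X 0) * rodState (n + 1) L a (Fin.snoc X s)) := by
    refine Measurable.stronglyMeasurable ?_
    refine Measurable.mul ?_ ?_
    · exact (measurable_rodState (n + 1) L a).comp
        ((continuous_snoc_const 0).measurable.comp measurable_snd)
    · exact (measurable_rodState (n + 1) L a).comp
        ((Continuous.finSnoc (A := fun _ : Fin (n + 1) => ℝ) continuous_fst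
          continuous_snd).measurable.comp (measurable_snd.prodMk measurable_fst))
  exact (hF.integral_prod_right'
    (ν := (volume : Measure (Fin n → ℝ)).restrict (Set.pi Set.univ fun _ => Set.Icc (0 : ℝ) L))).measurable

/-- **The zero-momentum occupation as an integral over the displacement**:
`c₀(N) = ∫₀ᴸ ρ_N(0, s) ds` (translation invariance and rotation invariance of Lebesgue measure on
the ring). [cite: MazzantiEtAl2008, p. 3] -/
theorem rodZeroMomentumOccupation_eq_integral_shift (hL : 0 < L) (a : ℝ) :
    rodZeroMomentumOccupation (n + 1) L a = ∫ s in Set.Icc 0 L, rodDensityMatrix (n + 1) L a 0 s := by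
  set g : ℝ → ℝ := fun s => rodDensityMatrix (n + 1) L a 0 s with hg
  have hgm : Measurable g := measurable_rodDensityMatrix_zero n L a
  have hIco : (Set.Ico (0 : ℝ) L) =ᵐ[volume] Set.Icc 0 L := Ico_ae_eq_Icc
  -- the inner integral does not depend on `x`
  have hinner : ∀ x ∈ Set.Ico (0 : ℝ) L,
      ∫ y in Set.Icc 0 L, rodDensityMatrix (n + 1) L a x y = ∫ s in Set.Icc 0 L, g s := by
    intro x hx
    rw [← setIntegral_congr_set hIco, ← setIntegral_congr_set hIco]
    have hpt : ∀ y ∈ Set.Ico (0 : ℝ) L, rodDensityMatrix (n + 1) L a x y = g (ringRotate hL (-x) y) := by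
      intro y hy
      rw [hg]
      simp only
      rw [rodDensityMatrix_eq_shift hL a hx hy]
      unfold ringRotate
      rw [sub_eq_add_neg]
    rw [setIntegral_congr_fun measurableSet_Ico hpt]
    have hmp := measurePreserving_ringRotate hL (-x)
    calc ∫ y in Set.Ico 0 L, g (ringRotate hL (-x) y)
        = ∫ y, g y ∂(Measure.map (ringRotate hL (-x)) (volume.restrict (Set.Ico 0 L))) :=
          (integral_map hmp.measurable.aemeasurable hgm.aestronglyMeasurable).symm
      _ = ∫ s in Set.Ico 0 L, g s := by rw [hmp.map_eq]
  unfold rodZeroMomentumOccupation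
  rw [← setIntegral_congr_set hIco, setIntegral_congr_fun measurableSet_Ico hinner, setIntegral_const,
    Real.volume_real_Ico_of_le hL.le, sub_zero, smul_eq_mul, ← mul_assoc, inv_mul_cancel₀ hL.ne',
    one_mul]

end Shift

end Literature.Barriers.AtomisticToContinuum.BoseGas

end
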